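/-
HONEST FRAMING: certified error envelopes and provably optimal rounding/accumulation schemes for
low-precision formats under stated cost models; every table by two implementations; no hardware
or vendor claims.
-/
import Mathlib.Data.Nat.BitIndices
import Summits.Ventures.CertifiedArithmetic.LowPrec.OptDemotionRoutingR17
import Summits.Ventures.CertifiedArithmetic.LowPrec.OptDemotionBudgetSound

/-!
# The demotion law (Theorem T8), part 8e: Conjecture D from the ROUTING CONJECTURE (opt gen 13, R16–R18 + §3)

The logical position of Conjecture D (OPTIMA.md §B T8(b)(iii): `s ≤ Q_t · fl_p(ŝ)` for every
summation tree `t` of nonnegative `F_q` data demoted once to `F_p`) after opt gen 13 and parts 7–8: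

* part 7b′ (`exact_le_phi`): for EVERY tree the exact sum is at most the budget relaxation
  `Φ*_(shape)` at the computed value (`Φ* = c + u · W`, the σ-flow value, opt C29);
* part 8d (`treeBR_le`, THEOREM R17): for EVERY tree the bit-routing value is bounded by `treeQf`,
  `u · BR_t(bits c) ≤ σ · (treeQf u t x - 1 - x)`, `c = σ (1 + x)`;
* THIS FILE: hence opt's ROUTING CONJECTURE for the shape of `t` — `Φ*_t(c) ≤ c + u · BR_t(bits c)`
  for every budget `c` ("carries never help", R18; `RoutingBound q s`, a decidable statement about
  one shape) — implies Conjecture D for `t`: ANY `p ≥ 1`, any nearest roundings into `F(q, emin)`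
  and `F(p, emin)`, any nonnegative data (`conjectureD_of_routingBound`), via the line of the full
  family `L_t` active at `x` (part 6a) and the every-tree root step (part 6b).
So what is left of Conjecture D for all trees is exactly `RoutingBound q s` for all shapes `s`
(opt R20 reduces it further to the two-tree inequality (TT)).  Also here: the bits `natBits m` of a
mantissa and their bookkeeping (`sum_natBits`, `natBits_routable`, `natBits_max'`).
-/

namespace Summit.Ventures.CertifiedArithmetic.LowPrec.Opt

open Literature.ComputerArithmetic.JeannerodRump2018
open Literature.ComputerArithmetic.JeannerodRump2018.SumTree

/-! ## The bits of a mantissa -/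

/-- The exponents of the binary expansion of a natural number. -/
def natBits (m : ℕ) : Finset ℤ := (m.bitIndices.map fun i : ℕ => (i : ℤ)).toFinset

/-- Membership: `e ∈ natBits m` iff `e = i` with bit `i` of `m` set. -/
theorem mem_natBits {m : ℕ} {e : ℤ} : e ∈ natBits m ↔ ∃ i : ℕ, m.testBit i = true ∧ (i : ℤ) = e := by
  simp [natBits, List.mem_toFinset, List.mem_map, Nat.mem_bitIndices]

/-- The bits sum to the number. -/
theorem sum_natBits (m : ℕ) : ∑ e ∈ natBits m, (2 : ℚ) ^ e = m := by
  have hnd : (m.bitIndices.map fun i : ℕ => (i : ℤ)).Nodup :=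
    List.Nodup.map Nat.cast_injective Nat.bitIndices_nodup
  rw [natBits, List.sum_toFinset _ hnd, List.map_map]
  have h := Nat.sum_map_two_pow_bitIndices m
  conv_rhs => rw [← h]
  rw [Nat.cast_list_sum, List.map_map]
  congr 1
  refine List.map_congr_left fun i _ => ?_
  simp

/-- Below `2^q` every bit index is `< q`. -/
theorem natBits_lt {q m : ℕ} (hm : m < 2 ^ q) {e : ℤ} (he : e ∈ natBits m) : 0 ≤ e ∧ e < q := by
  obtain ⟨i, hi, rfl⟩ := mem_natBits.1 he
  refine ⟨by positivity, ?_⟩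
  have h2 : 2 ^ i ≤ m := Nat.ge_two_pow_of_testBit hi
  have : i < q := by
    by_contra hle
    have : 2 ^ q ≤ 2 ^ i := Nat.pow_le_pow_right (by norm_num) (not_lt.1 hle)
    omega
  exact_mod_cast this

/-- The bits of `m < 2^q` are routable in precision `q`. -/
theorem natBits_routable {q m : ℕ} (hm : m < 2 ^ q) : Routable q (natBits m) := by
  intro e he e' he'
  have h1 := natBits_lt hm he
  have h2 := natBits_lt hm he'
  linarith

/-- The leading bit of a mantissa `m ∈ [2^(q-1), 2^q)` is `q - 1`. -/
theorem pred_mem_natBits {q m : ℕ} (hq : 1 ≤ q) (hm : 2 ^ (q - 1) ≤ m) (hm' : m < 2 ^ q) :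
    ((q : ℤ) - 1) ∈ natBits m := by
  rw [mem_natBits]
  refine ⟨q - 1, ?_, by push_cast [Nat.cast_sub hq]; ring⟩
  by_contra hbit
  have hfalse : ∀ i, i ≥ q - 1 → m.testBit i = false := by
    intro i hi
    rcases Nat.lt_or_ge i q with hlt | hge
    · have : i = q - 1 := by omega
      subst this
      simpa using hbit
    · exact Nat.testBit_lt_two_pow (lt_of_lt_of_le hm' (Nat.pow_le_pow_right (by norm_num) hge))
  have := Nat.lt_pow_two_of_testBit m hfalse
  omega

/-- … so `natBits m` is nonempty with maximum `q - 1`. -/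
theorem natBits_max' {q m : ℕ} (hq : 1 ≤ q) (hm : 2 ^ (q - 1) ≤ m) (hm' : m < 2 ^ q)
    (hne : (natBits m).Nonempty) : (natBits m).max' hne = (q : ℤ) - 1 := by
  refine le_antisymm (Finset.max'_le _ hne _ fun e he => ?_) (Finset.le_max' _ _ (pred_mem_natBits hq hm hm'))
  have := (natBits_lt hm' he).2; linarith

/-! ## The routing conjecture for a shape, and Conjecture D from it -/

/-- opt's ROUTING CONJECTURE (OPTIMA T8(b)(iii⁗) R18) FOR THE SHAPE `s` at precision `q`, in
budget-relaxation form (`Φ* = c + u · W` by C29): for every budget mantissa `m ∈ [2^(q-1), 2^q)`,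
`Φ*_s(m) ≤ m + u · BR_s(bits m)` — carries never help the adversary.  Decidable per shape;
certified by opt on every instance computed (C28: all shapes with ≤ 8/7/6/5 leaves at q = 4/5/6/7,
random shapes to 40 leaves, the C26 giants); OPEN in general. -/
def RoutingBound (q : ℕ) (s : Shape) : Prop :=
  ∀ m : ℕ, 2 ^ (q - 1) ≤ m → m < 2 ^ q →
    phi q s m ≤ (m : ℚ) + unitRoundoff q * treeBR q s.toTree (natBits m)

section ConjD

variable {q : ℕ} {emin : ℤ} {fl : ℚ → ℚ}

/-- **CONJECTURE D FROM THE ROUTING CONJECTURE** (every tree, every `p ≥ 1`, every `q ≥ 1`, any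
nearest roundings, nonnegative data): if the shape of `t` satisfies `RoutingBound q`, then
`s ≤ Q_t · fl_p(ŝ)`.  Chain: `exact ≤ Φ*` (7b′) `≤ ŝ + u·BR·scale` (hypothesis)
`≤ ŝ + ufp(ŝ)·(treeQf u t x - 1 - x)` (R17, 8d) `= ŝ + ufp(ŝ)(α - λ) + λ ŝ` for the line of `L_t`
active at `x` (6a) `⟹ s ≤ Q_t fl_p(ŝ)` (root step, 6b). -/
theorem conjectureD_of_routingBound {p : ℕ} (hp : 1 ≤ p) (hq : 1 ≤ q) {flp : ℚ → ℚ}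
    (hfl : IsRoundNearest q emin fl) (hflp : IsRoundNearest p emin flp) (t : SumTree)
    (ht : ∀ x ∈ leaves t, IsFloat q emin x ∧ 0 ≤ x) (hR : RoutingBound q (shapeOf t)) :
    exact t ≤ treeQf (unitRoundoff q) t (unitRoundoff p) * flp (eval fl t) := by
  set u := unitRoundoff q with hu
  have hu0 : 0 ≤ u := unitRoundoff_nonneg q
  have hu1 : u ≤ 1 := unitRoundoff_le_one q
  have hupos : 0 < u := by rw [hu]; unfold unitRoundoff; positivity
  obtain ⟨hzero, hposb⟩ := exact_le_phi hq hfl t ht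
  obtain ⟨hvF, hv0⟩ := eval_isFloat_nonneg hfl t ht
  refine exact_le_treeQf_mul_fl_of_invariant hp hfl hflp t ht hzero fun hpos => ?_
  set v := eval fl t with hv
  obtain ⟨hvcan, hm, hm'⟩ := float_canon hq hvF hpos
  set m := mant q v with hmdef
  set K := Int.log 2 v with hK
  set g := (2 : ℚ) ^ (K + 1 - q) with hg
  have h2 : (2 : ℚ) ≠ 0 := by norm_num
  have hgpos : 0 < g := zpow_pos (by norm_num) _
  have hσg : (2 : ℚ) ^ K = (2 : ℚ) ^ ((q : ℤ) - 1) * g := by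
    rw [hg, ← zpow_add₀ h2]; congr 1; ring
  -- exact ≤ g Φ*(m) ≤ g (m + u BR(bits m))
  have h1 : exact t ≤ g * ((m : ℚ) + u * treeBR q (shapeOf t).toTree (natBits m)) :=
    (hposb hpos).trans (mul_le_mul_of_nonneg_left (hR m hm hm') hgpos.le)
  -- the bits of m
  have hS := natBits_routable hm'
  have hne : (natBits m).Nonempty := ⟨_, pred_mem_natBits hq hm hm'⟩
  have htop := natBits_max' hq hm hm' hne
  have hsum := sum_natBits m
  by_cases hlow : ((natBits m).erase ((natBits m).max' hne)).Nonempty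
  · -- at least one lower bit: R17 and the active line at x = m/2^(q-1) - 1
    have hR17 := treeBR_le hq (shapeOf t).toTree hS hne hlow
    rw [htop, hsum, treeQf_toTree_shapeOf] at hR17
    set x : ℚ := (m : ℚ) / (2 : ℚ) ^ ((q : ℤ) - 1) - 1 with hx
    -- x > 0: m > 2^(q-1) since a second bit is set
    have hxpos : 0 < x := by
      obtain ⟨e, he⟩ := hlow
      have he' := Finset.mem_of_mem_erase he
      have hne' : e ≠ (q : ℤ) - 1 := by rw [← htop]; exact Finset.ne_of_mem_erase he
      have hlt : e < (q : ℤ) - 1 := lt_of_le_of_ne (by have := (natBits_lt hm' he').2; linarith) hne'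
      -- m ≥ 2^(q-1) + 2^e
      have h2e : (0 : ℚ) < (2 : ℚ) ^ e := zpow_pos (by norm_num) _
      have hge : (2 : ℚ) ^ ((q : ℤ) - 1) + (2 : ℚ) ^ e ≤ m := by
        rw [← hsum, ← Finset.add_sum_erase _ _ (pred_mem_natBits hq hm hm'),
          ← Finset.add_sum_erase _ _ (Finset.mem_erase.2 ⟨hne', he'⟩)]
        have : 0 ≤ ∑ x ∈ ((natBits m).erase ((q : ℤ) - 1)).erase e, (2 : ℚ) ^ x :=
          Finset.sum_nonneg fun i _ => (zpow_pos (by norm_num) i).le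
        linarith
      have hσ : (0 : ℚ) < (2 : ℚ) ^ ((q : ℤ) - 1) := zpow_pos (by norm_num) _
      rw [hx, sub_pos, lt_div_iff₀ hσ]; linarith
    obtain ⟨l, hl, hle⟩ := exists_allLine_eq_treeQf hupos t x hxpos
    refine ⟨l, hl, ?_⟩
    rw [← hu] at hR17
    -- assemble: exact ≤ v + σ (α + λ x) = v + σ(α - λ) + λ v
    have hσx : (2 : ℚ) ^ K * x = v - (2 : ℚ) ^ K := by
      rw [hx, hσg, hvcan]; field_simp
    have e1 : g * (m : ℚ) = v := by rw [hvcan, mul_comm]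
    have e2 : g * (u * treeBR q (shapeOf t).toTree (natBits m)) ≤
        (2 : ℚ) ^ K * (treeQf u t x - 1 - x) := by
      rw [hσg]
      calc g * (u * treeBR q (shapeOf t).toTree (natBits m))
          ≤ g * ((2 : ℚ) ^ ((q : ℤ) - 1) * (treeQf u t x - 1 - x)) :=
            mul_le_mul_of_nonneg_left hR17 hgpos.le
        _ = (2 : ℚ) ^ ((q : ℤ) - 1) * g * (treeQf u t x - 1 - x) := by ring
    have key : g * ((m : ℚ) + u * treeBR q (shapeOf t).toTree (natBits m)) ≤
        v + (2 : ℚ) ^ K * (treeQf u t x - 1 - x) := by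
      rw [mul_add]; linarith
    have hline : (2 : ℚ) ^ K * (treeQf u t x - 1 - x) = (2 : ℚ) ^ K * (l.1 - l.2) + l.2 * v := by
      have : treeQf u t x - 1 - x = l.1 + l.2 * x := by linarith
      have e3 : (2 : ℚ) ^ K * (l.2 * x) = l.2 * (v - (2 : ℚ) ^ K) := by rw [← hσx]; ring
      rw [this, mul_add, e3]; ring
    linarith
  · -- m = 2^(q-1): the μ-line
    refine ⟨(treeM u t - 1, 0), mu_mem_allLines hu0 hu1 t, ?_⟩
    have hS1 : natBits m = {(q : ℤ) - 1} := by
      rw [← htop]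
      refine Finset.eq_singleton_iff_unique_mem.2 ⟨Finset.max'_mem _ hne, fun e he => ?_⟩
      by_contra hne'
      exact hlow ⟨e, Finset.mem_erase.2 ⟨hne', he⟩⟩
    have hm1 : (m : ℚ) = (2 : ℚ) ^ ((q : ℤ) - 1) := by rw [← hsum, hS1, Finset.sum_singleton]
    have hv1 : v = (2 : ℚ) ^ K := by rw [hvcan, hm1, hσg]
    have hsing := treeBR_singleton hq (shapeOf t).toTree ((q : ℤ) - 1)
    rw [treeM_toTree_shapeOf, ← hu] at hsing
    rw [hS1] at h1
    show exact t - v ≤ (2 : ℚ) ^ K * ((treeM u t - 1) - 0) + 0 * v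
    rw [sub_zero, zero_mul, add_zero]
    have e1 : g * ((m : ℚ) + u * treeBR q (shapeOf t).toTree {(q : ℤ) - 1}) =
        v + (2 : ℚ) ^ K * (treeM u t - 1) := by
      rw [mul_add, hsing, hm1, hv1, hσg]; ring
    linarith

end ConjD


/-! ## Statement-style R4 propositions (rung bookkeeping, OPTIMA T8(b)(iii⁗)) -/

/-- R4 (Opt, CM-B demote, OPTIMA T8(b)(iii⁗)(R17)) THE BIT-ROUTING ENVELOPE: for every precision
`q ≥ 1`, every summation tree `t` and every routable configuration `S` of bits with leading bit
`e₀` and at least one lower bit, the bit-routing value is bounded by the coupled demotion polynomial: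
`u_q · BR_t(S) ≤ 2^e₀ · (treeQf u_q t x - 1 - x)` with `1 + x = (Σ_{e ∈ S} 2^e) / 2^e₀`. -/
def R4_BitRoutingEnvelope : Prop :=
  ∀ (q : ℕ), 1 ≤ q → ∀ (t : SumTree) (S : Finset ℤ), Routable q S → ∀ hne : S.Nonempty,
    (S.erase (S.max' hne)).Nonempty →
      unitRoundoff q * treeBR q t S ≤
        (2 : ℚ) ^ (S.max' hne) *
          (treeQf (unitRoundoff q) t ((∑ e ∈ S, (2 : ℚ) ^ e) / (2 : ℚ) ^ (S.max' hne) - 1) - 1 -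
            ((∑ e ∈ S, (2 : ℚ) ^ e) / (2 : ℚ) ^ (S.max' hne) - 1))

/-- Discharge of `R4_BitRoutingEnvelope` by THEOREM R17 (`treeBR_le`, part 8d). -/
theorem R4_BitRoutingEnvelope_holds : R4_BitRoutingEnvelope :=
  fun _ hq t _ hS hne hlow => treeBR_le hq t hS hne hlow

/-- R4 (Opt, CM-B demote, OPTIMA T8(b)(iii⁗)(R18)+(iii)) CONJECTURE D FROM THE ROUTING CONJECTURE:
for all `p, q ≥ 1`, any nearest roundings into `F(q, emin)` and `F(p, emin)`, and every summation
tree of nonnegative `F(q, emin)` data whose shape satisfies the routing bound `RoutingBound q`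
(opt's routing conjecture for that shape), `s ≤ Q_t · fl_p(ŝ)` with `Q_t = treeQf u_q t u_p`. -/
def R4_DemotionLawOfRouting : Prop :=
  ∀ (q p : ℕ) (emin : ℤ) (fl flp : ℚ → ℚ), 1 ≤ p → 1 ≤ q →
    IsRoundNearest q emin fl → IsRoundNearest p emin flp →
    ∀ t : SumTree, (∀ x ∈ leaves t, IsFloat q emin x ∧ 0 ≤ x) → RoutingBound q (shapeOf t) →
      exact t ≤ treeQf (unitRoundoff q) t (unitRoundoff p) * flp (eval fl t)

/-- Discharge of `R4_DemotionLawOfRouting` by `conjectureD_of_routingBound`. -/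
theorem R4_DemotionLawOfRouting_holds : R4_DemotionLawOfRouting :=
  fun _ _ _ _ _ hp hq hfl hflp t ht hR => conjectureD_of_routingBound hp hq hfl hflp t ht hR

end Summit.Ventures.CertifiedArithmetic.LowPrec.Opt
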